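import Summits.BirchSwinnertonDyer.BirchSwinnertonDyer.Theorems.SignedLowerHalvesKobayashiMainConjectureSmallImageTeichSpanHeckeMod
import Summits.BirchSwinnertonDyer.BirchSwinnertonDyer.Theorems.SignedLowerHalvesKobayashiMainConjectureSmallImageTeichSpanHeckeRelatorDefs
import HarnessLib

/-!
# Route `SignedLowerHalves`, child 23117 `SmallImageOneSignUnitContent` of crux 4 (stmt-BirchSwinnertonDyer-19002; line `birth_acns` v13,
# stub `stub_muOneSign_ns_ge5`): **the EXACT hinge — the rider ⟸ «B⁰ modulo the EIGEN-relators of the newform»**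
# (cell `bsd-ssimc`, LEAD seat `bsd-line-slh-p3` gen 11; THEOREMS ONLY; helper `--supports` item 23117)

Third cut of the B⁰_ss idea (g10: first cut `…TeichSpanHecke` = B⁰ modulo the `T_p`-images; second cut `…TeichSpanHeckeMod` = B⁰ modulo
`heckeRelators f p`, the `T_ℓ`-images for the primes with `p ∣ a_ℓ(f)`).  The Manin value of a `T_ℓ`-image word is
`2(a_ℓ[v/pⁿ]⁺ − (ℓ+1)[0]⁺)` (`sum_heckeLImage_eq`); multiplying by `γ^{−a_ℓ}` for a base-cusp element `γ` (`d(γ) = pⁿ`, `b(γ) ≡ v`)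
leaves `2(a_ℓ − ℓ − 1)[0]⁺`, killed mod `p` once `[0]⁺ ≡ 0` for EVERY good prime `ℓ ≠ p` — no congruence condition on `a_ℓ(f)`:

* `apply_zpow_eq` — an additive `m : Γ₀(N) → ℤ` has `m(γ^k) = k·m(γ)` (`k ∈ ℤ`);
* `isManinKilled_heckeEigenLImages` — the eigen-corrected `T_ℓ`-image words `heckeEigenLImages N p ℓ a_ℓ` are killed (any good `ℓ ≠ p`;
  the `[v/pⁿ]⁺` terms cancel, so NO integrality / Eisenstein-multiple input is used for them);
* `isManinKilled_heckeEigenRelators` — hence all of `heckeEigenRelators f p` (with the second cut's `isManinKilled_heckeRelators`);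
* `exists_sign_hasUnitContent_of_teichSpanGenMod_heckeEigenRelators` — **rider ⟸ `TeichSpanGenMod N p (heckeEigenRelators f p)`** at the
  newform's level (g10's generic dictionary `exists_sign_hasUnitContent_of_teichSpanGenMod`);
* `muOneSign_ns_ge5_of_teichSpanGenMod_heckeEigenRelators_conductor` — child 23117 / `stub_muOneSign_ns_ge5` VERBATIM ⟸ the eigen-hinge
  at the conductor level, per pair of the class; `…_of_heckeRelators_conductor'` records that g10's hypothesis implies this one.

WHY IT IS THE WEAKEST HYPOTHESIS OF THIS SHAPE.  Homologically the eigen-relators are `(T_ℓ − a_ℓ(f))·{0 → v/pⁿ} + c_ℓ` and the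
`T_p`-images; with the `p`-th powers of the B⁰ generators, ALL of `𝔪_f = (p, T_p, T_ℓ − a_ℓ(f) : ℓ ∤ Np)` is divided out: the hypothesis
says the Teichmüller packets span the `f`-ISOTYPIC part of `H₁(X₀(N);𝔽_p)⁺` (g10's second cut divided out only `(p, T_p, T_ℓ : p ∣ a_ℓ)`,
the `K`-dihedral supersingular part).  Under mod-`p` multiplicity one for `𝔪_f` the eigen-hinge is EQUIVALENT to the rider (a unit
Teichmüller-orbit sum of `φ_f⁺` exists iff the packets are not all in `𝔪_f H⁺ = ker(φ_f⁺ mod p)`), with no isolation condition — the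
converse is NOT formalised here (it needs Manin's `H₁ ≅ Γ₀(N)^{ab}/…` in the kernel); recorded as the reason this is the last cut.
HONEST SCOPE: the eigen-hinge is OPEN class-wide (= one-signed Perrin-Riou on the population); child 23117 / crux 4 NOT proved; no summit
statement and no BSD case is proved by any of this.

References: [MazurTateTeitelbaum1986Invent] §I.4 (4.2), §I.10 (10.1); [Manin1972] Prop. 1.4; [Serre1972] §1.11 Prop. 12;
[PollackWeston2011] Thm. 4.1 / Rem. 4.2 (the rider = one-signed μ); tree `…TeichSpanHeckeRelatorDefs` (third-cut defs, this seat),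
`…TeichSpanHeckeModPrelims`, `…TeichSpanHeckeMod` (g10).
-/

-- D-0017: single-problem summit, the namespace repeats the problem name by design.
set_option linter.dupNamespace false
set_option autoImplicit false

noncomputable section

open scoped Classical MatrixGroups ModularForm
open CongruenceSubgroup Literature.NumberTheory.EllipticCurves.Rank1Residual

namespace Summit.BirchSwinnertonDyer.BirchSwinnertonDyer.Theorems.SmallImageTeichSpanHeckeEigen

open Matrix Matrix.SpecialLinearGroup
  Literature.NumberTheory.EllipticCurves Literature.NumberTheory.EllipticCurves.ModularForms
  Literature.NumberTheory.EllipticCurves.Kobayashi2003 Literature.NumberTheory.EllipticCurves.GreenbergVatsal2000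
  Summit.BirchSwinnertonDyer.BirchSwinnertonDyer.Theorems.CollapseThree
  Summit.BirchSwinnertonDyer.BirchSwinnertonDyer.Theorems.PrintX8VerticalStevens
  Summit.BirchSwinnertonDyer.BirchSwinnertonDyer.Cruxes.AnalyticMuZeroX9.TeichSpan
  Summit.BirchSwinnertonDyer.BirchSwinnertonDyer.Theorems.SmallImageTeichSpanHecke
  Summit.BirchSwinnertonDyer.BirchSwinnertonDyer.Theorems.SmallImageTeichSpanHeckePrelims
  Summit.BirchSwinnertonDyer.BirchSwinnertonDyer.Theorems.SmallImageTeichSpanHeckeModPrelims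
  Summit.BirchSwinnertonDyer.BirchSwinnertonDyer.Theorems.SmallImageTeichSpanHeckeMod

/-! ### §1 Additive functions on `Γ₀(N)` and integer powers -/

section Additive

variable {N : ℕ}

/-- An additive `m : Γ₀(N) → ℤ` (`m 1 = 0`, `m(xy) = m x + m y`) satisfies `m(γ^k) = k·m(γ)` for every integer `k`
(it is a homomorphism to `ℤ`). [folklore] -/
theorem apply_zpow_eq {m : Gamma0 N → ℤ} (h1 : m 1 = 0) (hmul : ∀ x y : Gamma0 N, m (x * y) = m x + m y)
    (γ : Gamma0 N) (k : ℤ) : m (γ ^ k) = k * m γ := by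
  let φ : Gamma0 N →* Multiplicative ℤ :=
    { toFun := fun x => Multiplicative.ofAdd (m x)
      map_one' := by simp [h1]
      map_mul' := fun x y => by simp [hmul, ofAdd_add] }
  have h := map_zpow φ γ k
  have h' : Multiplicative.ofAdd (m (γ ^ k)) = Multiplicative.ofAdd (k • m γ) := by
    rw [ofAdd_zsmul]; exact h
  rw [Multiplicative.ofAdd.injective h', smul_eq_mul]

end Additive

/-! ### §2 The eigen-corrected `T_ℓ`-image words are killed, for EVERY good prime `ℓ ≠ p` -/

section Killed

variable {N : ℕ} [NeZero N] {f : CuspForm (Gamma0 N) 2} {p : ℕ} [Fact p.Prime]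

/-- **The eigen-corrected `T_ℓ`-images are killed** (`ℓ ≠ p` prime, `ℓ ∤ N`, `a_ℓ(f) = aℓ ∈ ℤ` — ANY integer eigenvalue; `p` odd;
`f` a rational normalised newform): `IsManinKilled f p (heckeEigenLImages N p ℓ aℓ)`.  The word part has Manin value
`m/2 = aℓ[v/pⁿ]⁺ − (ℓ+1)[0]⁺` (`sum_heckeLImage_eq`), the base element `m(γ)/2 = [v/pⁿ]⁺ − [0]⁺` (`[b(γ)/pⁿ]⁺ = [v/pⁿ]⁺` by periodicity),
so `m(R)/2 = (aℓ − ℓ − 1)[0]⁺`, of norm `< 1` — the `[v/pⁿ]⁺` terms CANCEL, so (unlike the `T_p`- and `p ∣ a_ℓ` cuts) no integrality /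
Eisenstein-multiple input and no `p ∤ N` is needed here. [cite: MazurTateTeitelbaum1986Invent, §I.4 (4.2)] [cite: Manin1972, Prop. 1.4] -/
theorem isManinKilled_heckeEigenLImages (hf : IsNewform0 f) (hQ : coeffField f = ⊥) (hp2 : p ≠ 2) {ℓ : ℕ}
    (hℓ : ℓ.Prime) (hℓp : ℓ ≠ p) (hℓN : ¬ ℓ ∣ N) {aℓ : ℤ} (haℓ : cuspCoeff f ℓ = aℓ) :
    IsManinKilled f p (heckeEigenLImages N p ℓ aℓ) := by
  intro m h1 hmul hcusp hzero R hR
  obtain ⟨n, b, g, gℓ, γ, hg, hdℓ, hbℓ, hdγ, hbγ, rfl⟩ := hR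
  have hp : p.Prime := Fact.out
  haveI : NeZero (p ^ n) := ⟨pow_ne_zero _ hp.ne_zero⟩
  have hpn0 : p ^ n ≠ 0 := pow_ne_zero _ hp.ne_zero
  have hrat : ∀ r : ℚ, (ratPlusSymbol f r : ℝ) = normalizedPlusSymbol f r := fun r ↦ ratCast_ratPlusSymbol_holds hf hQ r
  have hval := sum_heckeLImage_eq hf hℓ hℓp hℓN haℓ hrat (μ := fun γ ↦ (m γ : ℚ) / 2) (fun γ hd ↦ (hcusp γ hd).symm)
    n b hg hdℓ hbℓ
  set v : ℕ := (b : ZMod (p ^ n)).val with hv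
  have hvb : ((v : ℤ) : ZMod (p ^ n)) = (b : ZMod (p ^ n)) := by
    rw [hv, Int.cast_natCast, ZMod.natCast_zmod_val]
  -- the word part: `Σ_j m(g_j)/2 + m(g_ℓ)/2 = aℓ[v/pⁿ]⁺ − (ℓ+1)[0]⁺`
  have hsum2 : (((((List.ofFn g).map m).sum + m gℓ : ℤ) : ℚ) / 2 : ℚ) =
      (aℓ : ℚ) * ratPlusSymbol f ((v : ℚ) / (p : ℚ) ^ n) - ((ℓ : ℚ) + 1) * ratPlusSymbol f 0 := by
    rw [Int.cast_add, add_div, intCast_list_sum_div_two m, List.map_ofFn, List.sum_ofFn]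
    exact hval
  -- the base element `γ`: `m(γ)/2 = [v/pⁿ]⁺ − [0]⁺` (`[b(γ)/pⁿ]⁺ = [v/pⁿ]⁺` by periodicity, `b(γ) ≡ b ≡ v (mod pⁿ)`)
  have hγval : (m γ : ℚ) / 2 = ratPlusSymbol f ((v : ℚ) / (p : ℚ) ^ n) - ratPlusSymbol f 0 := by
    have hd0 : dEntry γ ≠ 0 := by rw [hdγ]; exact pow_ne_zero _ (by exact_mod_cast hp.ne_zero)
    rw [← hcusp γ hd0, hdγ]
    have e1 : (((p : ℤ) ^ n : ℤ) : ℚ) = ((p ^ n : ℕ) : ℚ) := by push_cast; ring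
    have e2 : (v : ℚ) / (p : ℚ) ^ n = ((v : ℤ) : ℚ) / ((p ^ n : ℕ) : ℚ) := by push_cast; ring
    rw [e1, e2, ratPlusSymbol_intCast_div_natCast_eq_of_intCast_eq f hpn0 (x := bEntry γ) (y := (v : ℤ))]
    rw [hbγ, hvb]
  -- Manin value of the relator: `m(R)/2 = (aℓ − ℓ − 1)[0]⁺`
  rw [hmul, hmul, apply_list_prod_eq_sum h1 hmul, apply_zpow_eq h1 hmul]
  apply dvd_of_norm_div_two_lt_one hp2
  have hrel : ((((List.ofFn g).map m).sum + m gℓ + -aℓ * m γ : ℤ) : ℚ) / 2 =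
      ((aℓ : ℚ) - ((ℓ : ℚ) + 1)) * ratPlusSymbol f 0 := by
    have e : ((((List.ofFn g).map m).sum + m gℓ + -aℓ * m γ : ℤ) : ℚ) / 2 =
        (((((List.ofFn g).map m).sum + m gℓ : ℤ) : ℚ) / 2) + (-(aℓ : ℚ)) * ((m γ : ℚ) / 2) := by
      push_cast; ring
    rw [e, hsum2, hγval]; ring
  rw [hrel]
  push_cast
  have hcoef : ‖((aℓ : ℚ_[p]) - ((ℓ : ℚ_[p]) + 1))‖ ≤ 1 := by
    have h : ‖((aℓ - (ℓ + 1) : ℤ) : ℚ_[p])‖ ≤ 1 := Padic.norm_int_le_one _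
    push_cast at h
    exact h
  exact padic_norm_mul_lt_one hcoef hzero

/-- **All eigen-relators of `f` at `p` are killed**: `IsManinKilled f p (heckeEigenRelators f p)` for a rational newform `f` on `Γ₀(N)`,
`p` odd, `p ∤ N`, `p ∣ a_p(f)`, with an Eisenstein multiple `n₀{∞,0} ∈ Λ_f` prime to `p` (second cut's `isManinKilled_heckeRelators` ∪ §2).
[cite: MazurTateTeitelbaum1986Invent, §I.4 (4.2)] [cite: Manin1972, Prop. 1.4] -/
theorem isManinKilled_heckeEigenRelators (hf : IsNewform0 f) (hQ : coeffField f = ⊥) (hp2 : p ≠ 2) (hpN : ¬ p ∣ N) {ap : ℤ}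
    (hap : cuspCoeff f p = ap) (hpap : (p : ℤ) ∣ ap) {n₀ : ℤ} (hpn₀ : ¬ (p : ℤ) ∣ n₀)
    (h0 : (n₀ : ℂ) * modularSymbol f 0 ∈ periodLattice f) : IsManinKilled f p (heckeEigenRelators f p) := by
  refine (isManinKilled_heckeRelators hf hQ hp2 hpN hap hpap hpn₀ h0).union (IsManinKilled.biUnion ?_)
  rintro ⟨ℓ, a⟩ ⟨hℓ, hℓp, hℓN, ha⟩
  exact isManinKilled_heckeEigenLImages hf hQ hp2 hℓ hℓp hℓN ha

end Killed

/-! ### §3 The rider ⟸ B⁰ modulo the eigen-relators (level form), and child 23117 VERBATIM (conductor level, per pair) -/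

section Rider

variable {N : ℕ} [NeZero N] (f : CuspForm (Gamma0 N) 2) {p : ℕ} [Fact p.Prime]

/-- **The one-sign μ-rider ⟸ B⁰ MODULO THE EIGEN-RELATORS OF THE NEWFORM** (`heckeEigenRelators f p`: `T_p`-images and, for EVERY
prime `ℓ ∤ Np`, the `T_ℓ`-image words corrected by `a_ℓ(f)` — all of `𝔪_f` divided out): for `W/ℚ` globally minimal with good reduction
at the odd prime `p`, `a_p = 0`, newform `f` of level `N`: `TeichSpanGenMod N p (heckeEigenRelators f p) → ∃ ε L, IsSignedPAdicLFunction f p ε L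
∧ HasUnitContent L`.  (Serre Prop. 12 ⇒ irreducible ⇒ Eisenstein multiple; §2; g10's generic dictionary.)
[cite: Serre1972, §1.11 Prop. 12] [cite: MazurTateTeitelbaum1986Invent, §I.4 (4.2), §I.10 (10.1)] [cite: Manin1972, Prop. 1.4] -/
theorem exists_sign_hasUnitContent_of_teichSpanGenMod_heckeEigenRelators {W : WeierstrassCurve ℚ} [W.IsElliptic]
    [W.IsGloballyMinimal] (hp2 : p ≠ 2) (hf : IsNewformOf W f) (hgood : W.HasGoodReductionAtPrime p)
    (hap : W.frobeniusTrace p = 0) (hB : TeichSpanGenMod N p (heckeEigenRelators f p)) :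
    ∃ (ε : ℤˣ) (L : IwasawaAlgebra p), IsSignedPAdicLFunction f p ε L ∧ HasUnitContent L := by
  have hpN : ¬ p ∣ N := not_dvd_level_of_isNewformOf hf hgood
  have hirr : W.HasIrreducibleModPGaloisRep p :=
    hasIrreducibleModPGaloisRep_of_dvd_frobeniusTrace W p hp2
      (W.not_dvd_minimalDiscriminantInt_of_hasGoodReductionAtPrime' p hgood) (by rw [hap]; exact dvd_zero _)
  obtain ⟨n₀, hpn₀, h0⟩ :=
    exists_intCast_mul_modularSymbol_zero_mem not_irreducible_of_frobeniusTrace_congr_holds hf hirr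
  exact exists_sign_hasUnitContent_of_teichSpanGenMod f hp2 hf hgood hap
    (isManinKilled_heckeEigenRelators hf.1 hf.coeffField_eq_bot hp2 hpN
      (cuspCoeff_eq_frobeniusTrace_of_isNewformOf_holds hf hgood) (by rw [hap]; exact dvd_zero _) hpn₀ h0) hB

end Rider

section Stub

/-- **Child 23117 `SmallImageOneSignUnitContent` = `stub_muOneSign_ns_ge5` of line `birth_acns` v13, VERBATIM, from «B⁰ modulo the
EIGEN-relators of the newform, at the CONDUCTOR LEVEL, for every pair of the class»**: for each `(E, p)` of the population (class X7,
non-CM, good supersingular `p ≥ 5`, `a_p = 0`, `ρ̄_{E,p}` not surjective) and its newform `f` of level `N_E`,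
`TeichSpanGenMod N_E p (heckeEigenRelators f p)` — the Teichmüller packets span the `f`-isotypic part of `H₁(X₀(N_E);𝔽_p)⁺` (the weakest
hypothesis of this shape; exact under mod-`p` multiplicity one).  Inside the second cut's hypothesis (`…_of_heckeRelators_conductor'`).
[cite: MazurTateTeitelbaum1986Invent, §I.4 (4.2), §I.10 (10.1)] [cite: PollackWeston2011, Thm. 4.1 (1)] -/
theorem muOneSign_ns_ge5_of_teichSpanGenMod_heckeEigenRelators_conductor
    (hB : ∀ (W : WeierstrassCurve ℚ) [W.IsElliptic] [W.IsGloballyMinimal] (p : ℕ) [Fact p.Prime], 5 ≤ p →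
      ClassX7 W p → ¬ W.HasCM → W.frobeniusTrace p = 0 → ¬ Surj W p →
      ∀ [NeZero (W.conductorNorm ℤ)] (f : CuspForm (Gamma0 (W.conductorNorm ℤ)) 2), IsNewformOf W f →
        TeichSpanGenMod (W.conductorNorm ℤ) p (heckeEigenRelators f p)) :
    ∀ (W : WeierstrassCurve ℚ) [W.IsElliptic] [W.IsGloballyMinimal] (p : ℕ) [Fact p.Prime], 5 ≤ p →
    ClassX7 W p → ¬ W.HasCM → W.frobeniusTrace p = 0 → ¬ Surj W p →
    ∀ [NeZero (W.conductorNorm ℤ)] (f : CuspForm (Gamma0 (W.conductorNorm ℤ)) 2),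
    IsNewformOf W f → ∃ (ε₀ : ℤˣ) (L₀ : IwasawaAlgebra p), IsSignedPAdicLFunction f p ε₀ L₀ ∧ HasUnitContent L₀ := by
  intro W _ _ p _ hp5 hX hCM hap hs _ f hf
  exact exists_sign_hasUnitContent_of_teichSpanGenMod_heckeEigenRelators f (by omega) hf hX.1.1 hap
    (hB W p hp5 hX hCM hap hs f hf)

/-- **The second cut's per-pair hypothesis implies the third cut's**: «B⁰ modulo `heckeRelators f p` at the conductor level, per pair»
⟹ «B⁰ modulo `heckeEigenRelators f p` at the conductor level, per pair» (more relators).  So this file's hypothesis is the WEAKEST of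
the three cuts (B⁰ ⟹ B⁰_ss ⟹ B⁰ mod `heckeRelators` ⟹ B⁰ mod `heckeEigenRelators` ⟹ rider). [cite: Manin1972, Prop. 1.4] -/
theorem teichSpanGenMod_heckeEigenRelators_conductor_of_heckeRelators_conductor
    (hB : ∀ (W : WeierstrassCurve ℚ) [W.IsElliptic] [W.IsGloballyMinimal] (p : ℕ) [Fact p.Prime], 5 ≤ p →
      ClassX7 W p → ¬ W.HasCM → W.frobeniusTrace p = 0 → ¬ Surj W p →
      ∀ [NeZero (W.conductorNorm ℤ)] (f : CuspForm (Gamma0 (W.conductorNorm ℤ)) 2), IsNewformOf W f →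
        TeichSpanGenMod (W.conductorNorm ℤ) p (heckeRelators f p)) :
    ∀ (W : WeierstrassCurve ℚ) [W.IsElliptic] [W.IsGloballyMinimal] (p : ℕ) [Fact p.Prime], 5 ≤ p →
      ClassX7 W p → ¬ W.HasCM → W.frobeniusTrace p = 0 → ¬ Surj W p →
      ∀ [NeZero (W.conductorNorm ℤ)] (f : CuspForm (Gamma0 (W.conductorNorm ℤ)) 2), IsNewformOf W f →
        TeichSpanGenMod (W.conductorNorm ℤ) p (heckeEigenRelators f p) := by
  intro W _ _ p _ hp5 hX hCM hap hs _ f hf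
  exact teichSpanGenMod_heckeEigenRelators_of_heckeRelators f (hB W p hp5 hX hCM hap hs f hf)

end Stub

end Summit.BirchSwinnertonDyer.BirchSwinnertonDyer.Theorems.SmallImageTeichSpanHeckeEigen

end
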